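import Literature.RepresentationTheory.HeisenbergGroup.SchrodingerPiWeilIdentity
import Literature.LinearAlgebra.QuadraticForm.LagrangianTransitive
import HarnessLib

/-!
# The big cell of `Sp(F^ι ⊕ F^ι)`: blocks, the criterion `det B ≠ 0`, and the factorisation `g = n(γ) m(B) w n(δ)`

Topic `RepresentationTheory/HeisenbergGroup`; namespace `Literature.RepresentationTheory.HeisenbergGroup`. KERNEL
mathematics only (definitions with bodies + theorems; no named fact, no `axiom`, no `sorry`). Pure linear algebra
over a field `F` (any characteristic for §1–§3; `2` invertible where Weil's section `n(c)` is used).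

For the standard symplectic space `W = X ⊕ Y`, `X = Y = F^ι`, with Weil's form `A((x,y),(x',y')) = ⟨x,y'⟩ - ⟨x',y⟩`
(`alt (polar (dotProductBilin F F))`, whose isometry group is the tree's `symplecticGroup (polar (dotProductBilin F F))`)
and the Lagrangian `ℓ_Y = 0 ⊕ Y` (`Submodule.prod ⊥ ⊤`, the one fixed by the Siegel parabolic `P = {n(c) m(a)}` of
the Schrödinger model on `𝒮(X)`), we write `g ∈ End(X ⊕ Y)` in blocks `g = (A B; C D)`,
`g(x, y) = (Ax + By, Cx + Dy)` ([Weil1964] n° 3, matrices `(α β; γ δ)`; [Rangarao1993] §2.2, §5.1), and prove: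

* §2 `A` is alternating and non-degenerate, `ℓ_Y^⊥ = ℓ_Y`; the identities `ᵗA C = ᵗC A`, `ᵗB D = ᵗD B`,
  `ᵗA D - ᵗC B = 1` of a symplectic `g` ([Weil1964] n° 3 (4)).
* §3 the relations among Weil's generators `n(c) : (x,y) ↦ (x, y + cx)` (`c` symmetric), `m(a) : (x,y) ↦ (ax, ᵗa⁻¹y)`,
  `w : (x,y) ↦ (y, -x)`: `n(c)n(c') = n(c+c')`, `m(a)m(a') = m(aa')`, `n(c)m(a) = m(a)n(ᵗa c a)`,
  `m(a)n(c) = n(ᵗa⁻¹ c a⁻¹)m(a)`, `w m(a) = m(ᵗa⁻¹) w` ([Weil1964] n° 6–7), and `n(c), m(a) ∈ P_{ℓ_Y}`.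
* §4 **the big cell** `Ω = {g : gℓ_Y ∩ ℓ_Y = 0}` (the tree's `bigCell`, [Weil1964] n° 7 / n° 33 `Ω = P w P`) is
  `{g : B invertible}` (`blockB_bijective_of_mem_bigCell`, `mem_bigCell_of_blockB_bijective`), and on it the
  **canonical factorisation** `g = n(D B⁻¹) m(B) w n(B⁻¹ A)` with `D B⁻¹`, `B⁻¹ A` symmetric and `ᵗB⁻¹ = D B⁻¹ A - C`
  (`eq_canonicalWord`) — the rank-`n` form of [Weil1964] n° 7 Prop. 1 ("tout élément de `Ω` s'écrit d'une manière
  unique `s = t(…) d(…) d'(…) t(…)`") used by [Rangarao1993] Thm 4.1 (4)–(5) and by the Schrödinger big-cell section.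

## References

* [Weil1964] A. Weil, *Sur certains groupes d'opérateurs unitaires*, Acta Math. 111 (1964): n° 3 (4) p. 148, n° 6–7
  pp. 151–153 (Prop. 1), n° 33 p. 187.
* [Rangarao1993] R. Ranga Rao, Pacific J. Math. 157 (1993): §2.2 p. 341, Thm 4.1 p. 358, §5.1 p. 360.
-/

set_option autoImplicit false

noncomputable section

namespace Literature.RepresentationTheory.HeisenbergGroup

open Matrix
open Literature.LinearAlgebra.QuadraticForm

/-! ## §1 Blocks of an automorphism of `X ⊕ Y` -/

section Blocks

variable {R : Type*} [Semiring R] {X : Type*} {Y : Type*} [AddCommMonoid X] [Module R X] [AddCommMonoid Y]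
  [Module R Y]

/-- the block `A = p_X g i_X : X → X` of `g = (A B; C D)`. [cite: Weil1964, n° 3, p. 147] -/
def blockA (g : (X × Y) ≃ₗ[R] (X × Y)) : X →ₗ[R] X :=
  LinearMap.fst R X Y ∘ₗ (g : (X × Y) →ₗ[R] (X × Y)) ∘ₗ LinearMap.inl R X Y

/-- the block `B = p_X g i_Y : Y → X` of `g = (A B; C D)`. [cite: Weil1964, n° 3, p. 147] -/
def blockB (g : (X × Y) ≃ₗ[R] (X × Y)) : Y →ₗ[R] X :=
  LinearMap.fst R X Y ∘ₗ (g : (X × Y) →ₗ[R] (X × Y)) ∘ₗ LinearMap.inr R X Y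

/-- the block `C = p_Y g i_X : X → Y` of `g = (A B; C D)`. [cite: Weil1964, n° 3, p. 147] -/
def blockC (g : (X × Y) ≃ₗ[R] (X × Y)) : X →ₗ[R] Y :=
  LinearMap.snd R X Y ∘ₗ (g : (X × Y) →ₗ[R] (X × Y)) ∘ₗ LinearMap.inl R X Y

/-- the block `D = p_Y g i_Y : Y → Y` of `g = (A B; C D)`. [cite: Weil1964, n° 3, p. 147] -/
def blockD (g : (X × Y) ≃ₗ[R] (X × Y)) : Y →ₗ[R] Y :=
  LinearMap.snd R X Y ∘ₗ (g : (X × Y) →ₗ[R] (X × Y)) ∘ₗ LinearMap.inr R X Y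

/-- `A x = (g(x,0))₁`. [cite: Weil1964, n° 3, p. 147] -/
@[simp] theorem blockA_apply (g : (X × Y) ≃ₗ[R] (X × Y)) (x : X) : blockA g x = (g (x, 0)).1 := rfl

/-- `B y = (g(0,y))₁`. [cite: Weil1964, n° 3, p. 147] -/
@[simp] theorem blockB_apply (g : (X × Y) ≃ₗ[R] (X × Y)) (y : Y) : blockB g y = (g (0, y)).1 := rfl

/-- `C x = (g(x,0))₂`. [cite: Weil1964, n° 3, p. 147] -/
@[simp] theorem blockC_apply (g : (X × Y) ≃ₗ[R] (X × Y)) (x : X) : blockC g x = (g (x, 0)).2 := rfl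

/-- `D y = (g(0,y))₂`. [cite: Weil1964, n° 3, p. 147] -/
@[simp] theorem blockD_apply (g : (X × Y) ≃ₗ[R] (X × Y)) (y : Y) : blockD g y = (g (0, y)).2 := rfl

/-- **`g(x, y) = (Ax + By, Cx + Dy)`**. [cite: Weil1964, n° 3, p. 147] -/
theorem apply_eq_blocks (g : (X × Y) ≃ₗ[R] (X × Y)) (x : X) (y : Y) :
    g (x, y) = (blockA g x + blockB g y, blockC g x + blockD g y) := by
  have h : ((x, y) : X × Y) = (x, (0 : Y)) + ((0 : X), y) := by rw [Prod.mk_add_mk, add_zero, zero_add]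
  rw [h, map_add]
  rfl

/-- the `B`-block of a product: `B(gh) = A(g)B(h) + B(g)D(h)`. [cite: Weil1964, n° 3, p. 147] -/
theorem blockB_mul_apply (g h : (X × Y) ≃ₗ[R] (X × Y)) (y : Y) :
    blockB (g * h) y = blockA g (blockB h y) + blockB g (blockD h y) := by
  rw [blockB_apply, LinearEquiv.mul_apply, show h (0, y) = (blockB h y, blockD h y) from Prod.ext rfl rfl,
    apply_eq_blocks]

end Blocks

/-! ## §2 `Sp(F^ι ⊕ F^ι)`: the form, the Lagrangian `ℓ_Y`, identities of a symplectic automorphism -/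

section Pi

variable {F : Type*} [Field F] {ι : Type*} [Fintype ι]

local notation "𝕍" => ((ι → F) × (ι → F))
local notation "Spι" => (symplecticGroup (polar (dotProductBilin F F (m := ι))))
local notation "ℓY" => (Submodule.prod (⊥ : Submodule F (ι → F)) (⊤ : Submodule F (ι → F)))

/-- Weil's form of the standard symplectic space: `A((x,y),(x',y')) = ⟨x,y'⟩ - ⟨x',y⟩`. [cite: Weil1964, n° 5, p. 150] -/
theorem alt_polar_dotProductBilin_apply (v w : 𝕍) :
    alt (polar (dotProductBilin F F (m := ι))) v w = v.1 ⬝ᵥ w.2 - w.1 ⬝ᵥ v.2 := by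
  rw [alt_apply, polar_apply, polar_apply, dotProductBilin_apply_apply, dotProductBilin_apply_apply]

/-- `A` is alternating. [cite: Weil1964, n° 5, p. 150] -/
theorem isAlt_alt_polar_dotProductBilin : (alt (polar (dotProductBilin F F (m := ι)))).IsAlt := fun v => by
  rw [alt_polar_dotProductBilin_apply]; exact sub_self _

/-- `A` is non-degenerate. [cite: Weil1964, n° 5, p. 150; Rangarao1993, §2.1] -/
theorem nondegenerate_alt_polar_dotProductBilin : (alt (polar (dotProductBilin F F (m := ι)))).Nondegenerate := by
  have hL : (alt (polar (dotProductBilin F F (m := ι)))).SeparatingLeft := by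
    intro p hp
    have h1 : p.1 = 0 := dotProduct_eq_zero _ fun y' => by
      have := hp (0, y')
      rw [alt_polar_dotProductBilin_apply] at this
      simpa using this
    have h2 : p.2 = 0 := dotProduct_eq_zero _ fun x' => by
      have := hp (x', 0)
      rw [alt_polar_dotProductBilin_apply] at this
      simp only [dotProduct_zero, zero_sub, neg_eq_zero] at this
      rwa [dotProduct_comm] at this
    exact Prod.ext h1 h2
  exact (LinearMap.IsRefl.nondegenerate_iff_separatingLeft isAlt_alt_polar_dotProductBilin.isRefl).2 hL

omit [Fintype ι] in
/-- `v ∈ ℓ_Y = 0 ⊕ Y ↔ v₁ = 0`. [cite: Rangarao1993, §2.2, p. 341] -/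
theorem mem_prod_bot_top_iff (v : 𝕍) : v ∈ ℓY ↔ v.1 = 0 := by
  rw [Submodule.mem_prod, Submodule.mem_bot]
  exact ⟨fun h => h.1, fun h => ⟨h, Submodule.mem_top⟩⟩

/-- **`ℓ_Y = 0 ⊕ Y` is a Lagrangian**: `ℓ_Y^⊥ = ℓ_Y`. [cite: Rangarao1993, §2.1–2.2, p. 341] -/
theorem orthogonal_prod_bot_top :
    LinearMap.BilinForm.orthogonal (alt (polar (dotProductBilin F F (m := ι)))) ℓY = ℓY := by
  ext v
  rw [LinearMap.BilinForm.mem_orthogonal_iff, mem_prod_bot_top_iff]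
  constructor
  · intro h
    refine dotProduct_eq_zero _ fun y' => ?_
    have := h (0, y') ((mem_prod_bot_top_iff _).2 rfl)
    rw [alt_polar_dotProductBilin_apply] at this
    simpa using this
  · intro hv n hn
    rw [alt_polar_dotProductBilin_apply, (mem_prod_bot_top_iff n).1 hn, hv, zero_dotProduct, zero_dotProduct,
      sub_zero]

/-- the invariance `A(gv, gw) = A(v, w)` of `g ∈ Sp` in coordinates. [cite: Weil1964, n° 3 (4), p. 148] -/
theorem sp_inv (g : Spι) (v w : 𝕍) :
    ((g : 𝕍 ≃ₗ[F] 𝕍) v).1 ⬝ᵥ ((g : 𝕍 ≃ₗ[F] 𝕍) w).2 - ((g : 𝕍 ≃ₗ[F] 𝕍) w).1 ⬝ᵥ ((g : 𝕍 ≃ₗ[F] 𝕍) v).2 =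
      v.1 ⬝ᵥ w.2 - w.1 ⬝ᵥ v.2 := by
  have h := (mem_symplecticGroup _ _).1 g.2 v w
  simpa only [polar_apply, dotProductBilin_apply_apply] using h

/-- `ᵗB D = ᵗD B`: `⟨By, Dy'⟩ = ⟨By', Dy⟩`. [cite: Weil1964, n° 3 (4), p. 148] -/
theorem blockB_dotProduct_blockD (g : Spι) (y y' : ι → F) :
    blockB (g : 𝕍 ≃ₗ[F] 𝕍) y ⬝ᵥ blockD (g : 𝕍 ≃ₗ[F] 𝕍) y' = blockB (g : 𝕍 ≃ₗ[F] 𝕍) y' ⬝ᵥ blockD (g : 𝕍 ≃ₗ[F] 𝕍) y := by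
  have h := sp_inv g (0, y) (0, y')
  simp only [zero_dotProduct, sub_zero, sub_eq_zero] at h
  exact h

/-- `ᵗA C = ᵗC A`: `⟨Ax, Cx'⟩ = ⟨Ax', Cx⟩`. [cite: Weil1964, n° 3 (4), p. 148] -/
theorem blockA_dotProduct_blockC (g : Spι) (x x' : ι → F) :
    blockA (g : 𝕍 ≃ₗ[F] 𝕍) x ⬝ᵥ blockC (g : 𝕍 ≃ₗ[F] 𝕍) x' = blockA (g : 𝕍 ≃ₗ[F] 𝕍) x' ⬝ᵥ blockC (g : 𝕍 ≃ₗ[F] 𝕍) x := by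
  have h := sp_inv g (x, 0) (x', 0)
  simp only [dotProduct_zero, sub_zero, sub_eq_zero] at h
  exact h

/-- `ᵗA D - ᵗC B = 1`: `⟨Ax, Dy⟩ - ⟨By, Cx⟩ = ⟨x, y⟩`. [cite: Weil1964, n° 3 (4), p. 148] -/
theorem blockA_dotProduct_blockD_sub (g : Spι) (x y : ι → F) :
    blockA (g : 𝕍 ≃ₗ[F] 𝕍) x ⬝ᵥ blockD (g : 𝕍 ≃ₗ[F] 𝕍) y - blockB (g : 𝕍 ≃ₗ[F] 𝕍) y ⬝ᵥ blockC (g : 𝕍 ≃ₗ[F] 𝕍) x =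
      x ⬝ᵥ y := by
  have h := sp_inv g (x, 0) (0, y)
  simp only [dotProduct_zero, sub_zero] at h
  exact h

/-! ## §3 Weil's generators `n(c)`, `m(a)`, `w` of `Sp(F^ι ⊕ F^ι)` and their relations -/

variable [DecidableEq ι] [Invertible (2 : F)]

local notation "𝐧" => unipotentSp (dotProductBilin F F (m := ι))
local notation "𝐦" a:max => leviSp (dotProductBilin F F (m := ι)) a (dualLeviPi a) (dotProductBilin_apply_dualLeviPi a)
local notation "𝐰" => weylSp (dotProductBilin F F (m := ι)) (LinearEquiv.refl F (ι → F)) (LinearEquiv.neg F)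
  dotProductBilin_refl_neg'

omit [DecidableEq ι] [Invertible (2 : F)] in
/-- the sum of two symmetric maps is symmetric (hypothesis of `n(c + c')`). [cite: Weil1964, n° 6, p. 151] -/
theorem symm_add {c c' : (ι → F) →ₗ[F] (ι → F)}
    (hc : ∀ x x' : ι → F, dotProductBilin F F x (c x') = dotProductBilin F F x' (c x))
    (hc' : ∀ x x' : ι → F, dotProductBilin F F x (c' x') = dotProductBilin F F x' (c' x)) :
    ∀ x x' : ι → F, dotProductBilin F F x ((c + c') x') = dotProductBilin F F x' ((c + c') x) := fun x x' => by
  rw [LinearMap.add_apply, LinearMap.add_apply, map_add, map_add, hc, hc']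

omit [DecidableEq ι] [Invertible (2 : F)] in
/-- the negative of a symmetric map is symmetric. [cite: Weil1964, n° 6, p. 151] -/
theorem symm_neg {c : (ι → F) →ₗ[F] (ι → F)}
    (hc : ∀ x x' : ι → F, dotProductBilin F F x (c x') = dotProductBilin F F x' (c x)) :
    ∀ x x' : ι → F, dotProductBilin F F x ((-c) x') = dotProductBilin F F x' ((-c) x) := fun x x' => by
  rw [LinearMap.neg_apply, LinearMap.neg_apply, map_neg, map_neg, hc]

omit [Invertible (2 : F)] in
/-- `ᵗa c a` is symmetric for `c` symmetric. [cite: Weil1964, n° 6, p. 151] -/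
theorem symm_transposePi_comp {c : (ι → F) →ₗ[F] (ι → F)}
    (hc : ∀ x x' : ι → F, dotProductBilin F F x (c x') = dotProductBilin F F x' (c x)) (a : (ι → F) ≃ₗ[F] (ι → F)) :
    ∀ x x' : ι → F,
      dotProductBilin F F x ((((transposePi a : (ι → F) ≃ₗ[F] (ι → F)) : (ι → F) →ₗ[F] (ι → F)) ∘ₗ c ∘ₗ
        ((a : (ι → F) ≃ₗ[F] (ι → F)) : (ι → F) →ₗ[F] (ι → F))) x') =
      dotProductBilin F F x' ((((transposePi a : (ι → F) ≃ₗ[F] (ι → F)) : (ι → F) →ₗ[F] (ι → F)) ∘ₗ c ∘ₗ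
        ((a : (ι → F) ≃ₗ[F] (ι → F)) : (ι → F) →ₗ[F] (ι → F))) x) := fun x x' => by
  simp only [LinearMap.comp_apply, LinearEquiv.coe_coe, dotProductBilin_transposePi]
  exact hc (a x) (a x')

omit [Invertible (2 : F)] in
/-- `ᵗa⁻¹ c a⁻¹` is symmetric for `c` symmetric. [cite: Weil1964, n° 6, p. 151] -/
theorem symm_dualLeviPi_comp {c : (ι → F) →ₗ[F] (ι → F)}
    (hc : ∀ x x' : ι → F, dotProductBilin F F x (c x') = dotProductBilin F F x' (c x)) (a : (ι → F) ≃ₗ[F] (ι → F)) :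
    ∀ x x' : ι → F,
      dotProductBilin F F x ((((dualLeviPi a : (ι → F) ≃ₗ[F] (ι → F)) : (ι → F) →ₗ[F] (ι → F)) ∘ₗ c ∘ₗ
        ((a.symm : (ι → F) ≃ₗ[F] (ι → F)) : (ι → F) →ₗ[F] (ι → F))) x') =
      dotProductBilin F F x' ((((dualLeviPi a : (ι → F) ≃ₗ[F] (ι → F)) : (ι → F) →ₗ[F] (ι → F)) ∘ₗ c ∘ₗ
        ((a.symm : (ι → F) ≃ₗ[F] (ι → F)) : (ι → F) →ₗ[F] (ι → F))) x) := fun x x' => by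
  simp only [LinearMap.comp_apply, LinearEquiv.coe_coe, dualLeviPi, dotProductBilin_transposePi]
  exact hc (a.symm x) (a.symm x')

omit [Invertible (2 : F)] in
/-- `ᵗa⁻¹ (ᵗa z) = z`. [cite: Weil1964, n° 6, p. 151] -/
theorem dualLeviPi_transposePi_apply (a : (ι → F) ≃ₗ[F] (ι → F)) (z : ι → F) : dualLeviPi a (transposePi a z) = z := by
  rw [dualLeviPi, ← transposePi_symm, LinearEquiv.symm_apply_apply]

omit [Invertible (2 : F)] in
/-- `ᵗ(-1) = -1` on `F^ι`: `dualLeviPi (-1) = -1`. [cite: Weil1964, n° 6, p. 151] -/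
theorem dualLeviPi_neg (z : ι → F) : dualLeviPi (LinearEquiv.neg F : (ι → F) ≃ₗ[F] (ι → F)) z = -z := by
  refine dotProduct_eq _ _ fun u => ?_
  rw [dotProduct_comm, dotProduct_dualLeviPi, LinearEquiv.symm_neg, LinearEquiv.neg_apply, neg_dotProduct,
    neg_dotProduct, dotProduct_comm]

omit [DecidableEq ι] in
/-- **`n(c) n(c') = n(c + c')`**. [cite: Weil1964, n° 6, p. 151] -/
theorem unipotentSp_mul_unipotentSp (c c' : (ι → F) →ₗ[F] (ι → F))
    (hc : ∀ x x' : ι → F, dotProductBilin F F x (c x') = dotProductBilin F F x' (c x))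
    (hc' : ∀ x x' : ι → F, dotProductBilin F F x (c' x') = dotProductBilin F F x' (c' x)) :
    𝐧 c hc * 𝐧 c' hc' = 𝐧 (c + c') (symm_add hc hc') := by
  apply Subtype.ext; apply LinearEquiv.ext; rintro ⟨x, y⟩
  simp only [Subgroup.coe_mul, LinearEquiv.mul_apply, coe_unipotentSp, unipotentσ_apply, LinearMap.add_apply,
    Prod.mk.injEq, true_and]
  abel

omit [Invertible (2 : F)] in
/-- **`m(a) m(a') = m(a a')`**. [cite: Weil1964, n° 6, p. 151] -/
theorem leviSp_mul_leviSp (a a' : (ι → F) ≃ₗ[F] (ι → F)) : 𝐦 a * 𝐦 a' = 𝐦 (a * a') := by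
  apply Subtype.ext; apply LinearEquiv.ext; rintro ⟨x, y⟩
  simp only [Subgroup.coe_mul, LinearEquiv.mul_apply, coe_leviSp_apply, dualLeviPi_mul]

/-- **`n(c) m(a) = m(a) n(ᵗa c a)`**. [cite: Weil1964, n° 6, p. 151] -/
theorem unipotentSp_mul_leviSp (c : (ι → F) →ₗ[F] (ι → F))
    (hc : ∀ x x' : ι → F, dotProductBilin F F x (c x') = dotProductBilin F F x' (c x)) (a : (ι → F) ≃ₗ[F] (ι → F)) :
    𝐧 c hc * 𝐦 a =
      𝐦 a * 𝐧 ((((transposePi a : (ι → F) ≃ₗ[F] (ι → F)) : (ι → F) →ₗ[F] (ι → F)) ∘ₗ c ∘ₗ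
        ((a : (ι → F) ≃ₗ[F] (ι → F)) : (ι → F) →ₗ[F] (ι → F)))) (symm_transposePi_comp hc a) := by
  apply Subtype.ext; apply LinearEquiv.ext; rintro ⟨x, y⟩
  simp only [Subgroup.coe_mul, LinearEquiv.mul_apply, coe_unipotentSp, unipotentσ_apply, coe_leviSp_apply,
    LinearMap.comp_apply, LinearEquiv.coe_coe, map_add, dualLeviPi_transposePi_apply]

/-- **`m(a) n(c) = n(ᵗa⁻¹ c a⁻¹) m(a)`**. [cite: Weil1964, n° 6, p. 151] -/
theorem leviSp_mul_unipotentSp (a : (ι → F) ≃ₗ[F] (ι → F)) (c : (ι → F) →ₗ[F] (ι → F))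
    (hc : ∀ x x' : ι → F, dotProductBilin F F x (c x') = dotProductBilin F F x' (c x)) :
    𝐦 a * 𝐧 c hc =
      𝐧 ((((dualLeviPi a : (ι → F) ≃ₗ[F] (ι → F)) : (ι → F) →ₗ[F] (ι → F)) ∘ₗ c ∘ₗ
        ((a.symm : (ι → F) ≃ₗ[F] (ι → F)) : (ι → F) →ₗ[F] (ι → F)))) (symm_dualLeviPi_comp hc a) * 𝐦 a := by
  apply Subtype.ext; apply LinearEquiv.ext; rintro ⟨x, y⟩
  simp only [Subgroup.coe_mul, LinearEquiv.mul_apply, coe_unipotentSp, unipotentσ_apply, coe_leviSp_apply,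
    LinearMap.comp_apply, LinearEquiv.coe_coe, map_add, LinearEquiv.symm_apply_apply]

omit [Invertible (2 : F)] in
/-- **`w m(a) = m(ᵗa⁻¹) w`**. [cite: Weil1964, n° 6, p. 151] -/
theorem weylSp_mul_leviSp (a : (ι → F) ≃ₗ[F] (ι → F)) : 𝐰 * 𝐦 a = 𝐦 (dualLeviPi a) * 𝐰 := by
  apply Subtype.ext; apply LinearEquiv.ext; rintro ⟨x, y⟩
  simp only [Subgroup.coe_mul, LinearEquiv.mul_apply, coe_weylSp, weylσ_apply, coe_leviSp_apply,
    LinearEquiv.refl_apply, LinearEquiv.neg_apply, map_neg, dualLeviPi_dualLeviPi]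

omit [Fintype ι] [DecidableEq ι] [Invertible (2 : F)] in
/-- a subspace-preserving criterion: `p ℓ_Y = ℓ_Y` as soon as `(pv)₁ = 0 ↔ v₁ = 0`. [cite: Rangarao1993, §2.2, p. 341] -/
theorem map_prod_bot_top_eq_of (p : 𝕍 ≃ₗ[F] 𝕍) (h : ∀ v : 𝕍, (p v).1 = 0 ↔ v.1 = 0) :
    Submodule.map (p : 𝕍 →ₗ[F] 𝕍) ℓY = ℓY := by
  ext v
  rw [Submodule.mem_map, mem_prod_bot_top_iff]
  constructor
  · rintro ⟨u, hu, rfl⟩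
    rw [LinearEquiv.coe_coe, h]
    exact (mem_prod_bot_top_iff u).1 hu
  · intro hv
    refine ⟨p.symm v, (mem_prod_bot_top_iff _).2 ((h _).1 ?_), p.apply_symm_apply v⟩
    rwa [LinearEquiv.apply_symm_apply]

omit [DecidableEq ι] in
/-- **`n(c) ∈ P_{ℓ_Y}`**: `n(c) ℓ_Y = ℓ_Y`. [cite: Rangarao1993, §2.2, p. 341; Weil1964, n° 7, p. 152] -/
theorem map_unipotentSp_prod_bot_top (c : (ι → F) →ₗ[F] (ι → F))
    (hc : ∀ x x' : ι → F, dotProductBilin F F x (c x') = dotProductBilin F F x' (c x)) :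
    Submodule.map (((𝐧 c hc : Spι) : 𝕍 ≃ₗ[F] 𝕍) : 𝕍 →ₗ[F] 𝕍) ℓY = ℓY :=
  map_prod_bot_top_eq_of _ fun v => by rw [coe_unipotentSp, unipotentσ_apply]

omit [Invertible (2 : F)] in
/-- **`m(a) ∈ P_{ℓ_Y}`**: `m(a) ℓ_Y = ℓ_Y`. [cite: Rangarao1993, §2.2, p. 341; Weil1964, n° 7, p. 152] -/
theorem map_leviSp_prod_bot_top (a : (ι → F) ≃ₗ[F] (ι → F)) :
    Submodule.map (((𝐦 a : Spι) : 𝕍 ≃ₗ[F] 𝕍) : 𝕍 →ₗ[F] 𝕍) ℓY = ℓY :=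
  map_prod_bot_top_eq_of _ fun v => by rw [coe_leviSp_apply]; exact a.map_eq_zero_iff

omit [DecidableEq ι] [Invertible (2 : F)] in
/-- the isometry property of an element of `Sp`, in the form the Leray-cocycle lemmas consume.
[cite: Weil1964, n° 3 (4), p. 148] -/
theorem sp_isometry (g : Spι) (v w : 𝕍) :
    alt (polar (dotProductBilin F F (m := ι))) ((g : 𝕍 ≃ₗ[F] 𝕍) v) ((g : 𝕍 ≃ₗ[F] 𝕍) w) =
      alt (polar (dotProductBilin F F (m := ι))) v w :=
  (Heisenberg.PseudoSymplectic.mem_isometries _ _).1 g.2 v w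

/-- **the canonical word `n(γ) m(B) w n(δ)` acts by `(x, y) ↦ (B(y + δx), γ B(y + δx) - ᵗB⁻¹ x)`**.
[cite: Weil1964, n° 7, Prop. 1, p. 152] -/
theorem canonicalWord_apply (γ δ : (ι → F) →ₗ[F] (ι → F))
    (hγ : ∀ x x' : ι → F, dotProductBilin F F x (γ x') = dotProductBilin F F x' (γ x))
    (hδ : ∀ x x' : ι → F, dotProductBilin F F x (δ x') = dotProductBilin F F x' (δ x))
    (Bₑ : (ι → F) ≃ₗ[F] (ι → F)) (v : 𝕍) :
    ((𝐧 γ hγ * 𝐦 Bₑ * 𝐰 * 𝐧 δ hδ : Spι) : 𝕍 ≃ₗ[F] 𝕍) v =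
      (Bₑ (v.2 + δ v.1), γ (Bₑ (v.2 + δ v.1)) - dualLeviPi Bₑ v.1) := by
  simp only [Subgroup.coe_mul, LinearEquiv.mul_apply, coe_unipotentSp, unipotentσ_apply, coe_weylSp, weylσ_apply,
    coe_leviSp_apply, LinearEquiv.refl_apply, LinearEquiv.neg_apply, map_neg, Prod.mk.injEq, true_and]
  abel

/-- the `B`-block of the canonical word `n(γ) m(B) w n(δ)` is `B`. [cite: Weil1964, n° 7, Prop. 1, p. 152] -/
theorem blockB_canonicalWord (γ δ : (ι → F) →ₗ[F] (ι → F))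
    (hγ : ∀ x x' : ι → F, dotProductBilin F F x (γ x') = dotProductBilin F F x' (γ x))
    (hδ : ∀ x x' : ι → F, dotProductBilin F F x (δ x') = dotProductBilin F F x' (δ x))
    (Bₑ : (ι → F) ≃ₗ[F] (ι → F)) (y : ι → F) :
    blockB ((𝐧 γ hγ * 𝐦 Bₑ * 𝐰 * 𝐧 δ hδ : Spι) : 𝕍 ≃ₗ[F] 𝕍) y = Bₑ y := by
  rw [blockB_apply, canonicalWord_apply γ δ hγ hδ Bₑ]; simp

/-- the `A`-block of the canonical word is `B δ`. [cite: Weil1964, n° 7, Prop. 1, p. 152] -/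
theorem blockA_canonicalWord (γ δ : (ι → F) →ₗ[F] (ι → F))
    (hγ : ∀ x x' : ι → F, dotProductBilin F F x (γ x') = dotProductBilin F F x' (γ x))
    (hδ : ∀ x x' : ι → F, dotProductBilin F F x (δ x') = dotProductBilin F F x' (δ x))
    (Bₑ : (ι → F) ≃ₗ[F] (ι → F)) (x : ι → F) :
    blockA ((𝐧 γ hγ * 𝐦 Bₑ * 𝐰 * 𝐧 δ hδ : Spι) : 𝕍 ≃ₗ[F] 𝕍) x = Bₑ (δ x) := by
  rw [blockA_apply, canonicalWord_apply γ δ hγ hδ Bₑ]; simp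

/-- the `D`-block of the canonical word is `γ B`. [cite: Weil1964, n° 7, Prop. 1, p. 152] -/
theorem blockD_canonicalWord (γ δ : (ι → F) →ₗ[F] (ι → F))
    (hγ : ∀ x x' : ι → F, dotProductBilin F F x (γ x') = dotProductBilin F F x' (γ x))
    (hδ : ∀ x x' : ι → F, dotProductBilin F F x (δ x') = dotProductBilin F F x' (δ x))
    (Bₑ : (ι → F) ≃ₗ[F] (ι → F)) (y : ι → F) :
    blockD ((𝐧 γ hγ * 𝐦 Bₑ * 𝐰 * 𝐧 δ hδ : Spι) : 𝕍 ≃ₗ[F] 𝕍) y = γ (Bₑ y) := by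
  rw [blockD_apply, canonicalWord_apply γ δ hγ hδ Bₑ]; simp

/-! ## §4 The big cell `Ω = {g : B invertible}` and the factorisation `g = n(DB⁻¹) m(B) w n(B⁻¹A)` -/

omit [DecidableEq ι] [Invertible (2 : F)] in
/-- **`g ∈ Ω` (i.e. `gℓ_Y ∩ ℓ_Y = 0`) forces `B` invertible**. [cite: Weil1964, n° 7, p. 152; Rangarao1993, §5.1, p. 360] -/
theorem blockB_bijective_of_mem_bigCell (g : Spι) (hg : g ∈ bigCell (alt (polar (dotProductBilin F F (m := ι)))) ℓY) :
    Function.Bijective (blockB (g : 𝕍 ≃ₗ[F] 𝕍)) := by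
  have hg' : IsCompl (Submodule.map ((g : 𝕍 ≃ₗ[F] 𝕍) : 𝕍 →ₗ[F] 𝕍) ℓY) ℓY := hg
  have hinj : Function.Injective (blockB (g : 𝕍 ≃ₗ[F] 𝕍)) := by
    refine (injective_iff_map_eq_zero _).2 fun y hy => ?_
    rw [blockB_apply] at hy
    have h1 : (g : 𝕍 ≃ₗ[F] 𝕍) (0, y) ∈ Submodule.map ((g : 𝕍 ≃ₗ[F] 𝕍) : 𝕍 →ₗ[F] 𝕍) ℓY :=
      Submodule.mem_map_of_mem ((mem_prod_bot_top_iff _).2 rfl)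
    have h2 : (g : 𝕍 ≃ₗ[F] 𝕍) (0, y) ∈ ℓY := (mem_prod_bot_top_iff _).2 hy
    have h0 := (Submodule.disjoint_def.1 hg'.disjoint) _ h1 h2
    rw [LinearEquiv.map_eq_zero_iff, Prod.mk_eq_zero] at h0
    exact h0.2
  exact ⟨hinj, LinearMap.surjective_of_injective hinj⟩

omit [DecidableEq ι] [Invertible (2 : F)] in
/-- conversely **`B` invertible puts `g` in `Ω`**. [cite: Weil1964, n° 7, p. 152; Rangarao1993, §5.1, p. 360] -/
theorem mem_bigCell_of_blockB_bijective (g : Spι) (hB : Function.Bijective (blockB (g : 𝕍 ≃ₗ[F] 𝕍))) :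
    g ∈ bigCell (alt (polar (dotProductBilin F F (m := ι)))) ℓY := by
  show IsCompl (Submodule.map ((g : 𝕍 ≃ₗ[F] 𝕍) : 𝕍 →ₗ[F] 𝕍) ℓY) ℓY
  rw [isCompl_iff]
  constructor
  · rw [Submodule.disjoint_def]
    rintro v ⟨u, hu, rfl⟩ hv
    rw [SetLike.mem_coe, mem_prod_bot_top_iff] at hu
    rw [mem_prod_bot_top_iff, LinearEquiv.coe_coe] at hv
    have hu' : u = (0, u.2) := Prod.ext hu rfl
    rw [hu'] at hv ⊢
    have h2 : u.2 = 0 := hB.1 (by rw [blockB_apply, hv, map_zero])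
    rw [LinearEquiv.coe_coe, h2, Prod.mk_zero_zero, map_zero]
  · rw [codisjoint_iff, eq_top_iff]
    rintro v -
    obtain ⟨y₀, hy₀⟩ := hB.2 v.1
    rw [blockB_apply] at hy₀
    rw [Submodule.mem_sup]
    refine ⟨(g : 𝕍 ≃ₗ[F] 𝕍) (0, y₀), Submodule.mem_map_of_mem ((mem_prod_bot_top_iff _).2 rfl),
      v - (g : 𝕍 ≃ₗ[F] 𝕍) (0, y₀), (mem_prod_bot_top_iff _).2 ?_, add_sub_cancel _ _⟩
    rw [Prod.fst_sub, hy₀, sub_self]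

omit [Fintype ι] [DecidableEq ι] [Invertible (2 : F)] in
/-- the block `B` of `g ∈ Ω` as an automorphism of `F^ι`. [cite: Weil1964, n° 7, Prop. 1, p. 152] -/
def cellB (g : 𝕍 ≃ₗ[F] 𝕍) (hB : Function.Bijective (blockB g)) : (ι → F) ≃ₗ[F] (ι → F) :=
  LinearEquiv.ofBijective (blockB g) hB

omit [Fintype ι] [DecidableEq ι] [Invertible (2 : F)] in
/-- `cellB g hB y = B y`. [cite: Weil1964, n° 7, Prop. 1, p. 152] -/
@[simp] theorem cellB_apply (g : 𝕍 ≃ₗ[F] 𝕍) (hB : Function.Bijective (blockB g)) (y : ι → F) :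
    cellB g hB y = blockB g y := rfl

omit [Fintype ι] [DecidableEq ι] [Invertible (2 : F)] in
/-- `B (B⁻¹ x) = x`. [cite: Weil1964, n° 7, Prop. 1, p. 152] -/
@[simp] theorem blockB_cellB_symm_apply (g : 𝕍 ≃ₗ[F] 𝕍) (hB : Function.Bijective (blockB g)) (x : ι → F) :
    blockB g ((cellB g hB).symm x) = x :=
  (cellB g hB).apply_symm_apply x

omit [Fintype ι] [DecidableEq ι] [Invertible (2 : F)] in
/-- `B⁻¹ (B y) = y`. [cite: Weil1964, n° 7, Prop. 1, p. 152] -/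
@[simp] theorem cellB_symm_apply_blockB (g : 𝕍 ≃ₗ[F] 𝕍) (hB : Function.Bijective (blockB g)) (y : ι → F) :
    (cellB g hB).symm (blockB g y) = y :=
  (cellB g hB).symm_apply_apply y

omit [Fintype ι] [DecidableEq ι] [Invertible (2 : F)] in
/-- the symmetric map `γ = D B⁻¹` of `g ∈ Ω`. [cite: Weil1964, n° 7, Prop. 1, p. 152] -/
def cellGamma (g : 𝕍 ≃ₗ[F] 𝕍) (hB : Function.Bijective (blockB g)) : (ι → F) →ₗ[F] (ι → F) :=
  blockD g ∘ₗ ((cellB g hB).symm : (ι → F) →ₗ[F] (ι → F))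

omit [Fintype ι] [DecidableEq ι] [Invertible (2 : F)] in
/-- the symmetric map `δ = B⁻¹ A` of `g ∈ Ω`. [cite: Weil1964, n° 7, Prop. 1, p. 152] -/
def cellDelta (g : 𝕍 ≃ₗ[F] 𝕍) (hB : Function.Bijective (blockB g)) : (ι → F) →ₗ[F] (ι → F) :=
  ((cellB g hB).symm : (ι → F) →ₗ[F] (ι → F)) ∘ₗ blockA g

omit [Fintype ι] [DecidableEq ι] [Invertible (2 : F)] in
/-- `γ x = D (B⁻¹ x)`. [cite: Weil1964, n° 7, Prop. 1, p. 152] -/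
@[simp] theorem cellGamma_apply (g : 𝕍 ≃ₗ[F] 𝕍) (hB : Function.Bijective (blockB g)) (x : ι → F) :
    cellGamma g hB x = blockD g ((cellB g hB).symm x) := rfl

omit [Fintype ι] [DecidableEq ι] [Invertible (2 : F)] in
/-- `δ x = B⁻¹ (A x)`. [cite: Weil1964, n° 7, Prop. 1, p. 152] -/
@[simp] theorem cellDelta_apply (g : 𝕍 ≃ₗ[F] 𝕍) (hB : Function.Bijective (blockB g)) (x : ι → F) :
    cellDelta g hB x = (cellB g hB).symm (blockA g x) := rfl

omit [DecidableEq ι] [Invertible (2 : F)] in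
/-- **`γ = D B⁻¹` is symmetric** (`ᵗB D = ᵗD B`). [cite: Weil1964, n° 7, Prop. 1, p. 152] -/
theorem cellGamma_symm (g : Spι) (hB : Function.Bijective (blockB (g : 𝕍 ≃ₗ[F] 𝕍))) :
    ∀ x x' : ι → F, dotProductBilin F F x (cellGamma (g : 𝕍 ≃ₗ[F] 𝕍) hB x') =
      dotProductBilin F F x' (cellGamma (g : 𝕍 ≃ₗ[F] 𝕍) hB x) := fun x x' => by
  rw [dotProductBilin_apply_apply, dotProductBilin_apply_apply, cellGamma_apply, cellGamma_apply]
  have h := blockB_dotProduct_blockD g ((cellB (g : 𝕍 ≃ₗ[F] 𝕍) hB).symm x) ((cellB (g : 𝕍 ≃ₗ[F] 𝕍) hB).symm x')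
  rwa [blockB_cellB_symm_apply, blockB_cellB_symm_apply] at h

omit [DecidableEq ι] [Invertible (2 : F)] in
/-- **`δ = B⁻¹ A` is symmetric** (`A ᵗB = B ᵗA`; proof through the isotropy of `ℓ_Y`: `g(x, -δx) ∈ ℓ_Y`).
[cite: Weil1964, n° 7, Prop. 1, p. 152] -/
theorem cellDelta_symm (g : Spι) (hB : Function.Bijective (blockB (g : 𝕍 ≃ₗ[F] 𝕍))) :
    ∀ x x' : ι → F, dotProductBilin F F x (cellDelta (g : 𝕍 ≃ₗ[F] 𝕍) hB x') =
      dotProductBilin F F x' (cellDelta (g : 𝕍 ≃ₗ[F] 𝕍) hB x) := fun x x' => by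
  rw [dotProductBilin_apply_apply, dotProductBilin_apply_apply]
  have h0 : ∀ z : ι → F, ((g : 𝕍 ≃ₗ[F] 𝕍) (z, -cellDelta (g : 𝕍 ≃ₗ[F] 𝕍) hB z)).1 = 0 := fun z => by
    rw [apply_eq_blocks, map_neg, cellDelta_apply, blockB_cellB_symm_apply, add_neg_cancel]
  have h := sp_inv g (x, -cellDelta (g : 𝕍 ≃ₗ[F] 𝕍) hB x) (x', -cellDelta (g : 𝕍 ≃ₗ[F] 𝕍) hB x')
  rw [h0, h0, zero_dotProduct, zero_dotProduct, sub_zero, dotProduct_neg, dotProduct_neg] at h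
  linear_combination h

omit [Invertible (2 : F)] in
/-- **`ᵗB⁻¹ = D B⁻¹ A - C` on `Ω`** (the identity `ᵗA D - ᵗC B = 1` solved for `C`).
[cite: Weil1964, n° 7, Prop. 1, p. 152] -/
theorem dualLeviPi_cellB_apply (g : Spι) (hB : Function.Bijective (blockB (g : 𝕍 ≃ₗ[F] 𝕍))) (x : ι → F) :
    dualLeviPi (cellB (g : 𝕍 ≃ₗ[F] 𝕍) hB) x =
      blockD (g : 𝕍 ≃ₗ[F] 𝕍) ((cellB (g : 𝕍 ≃ₗ[F] 𝕍) hB).symm (blockA (g : 𝕍 ≃ₗ[F] 𝕍) x)) -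
        blockC (g : 𝕍 ≃ₗ[F] 𝕍) x := by
  refine dotProduct_eq _ _ fun u => ?_
  obtain ⟨y', rfl⟩ := hB.2 u
  rw [dotProduct_comm, dotProduct_dualLeviPi, cellB_symm_apply_blockB, sub_dotProduct, dotProduct_comm (blockD _ _),
    blockB_dotProduct_blockD g y', blockB_cellB_symm_apply, dotProduct_comm (blockC _ _), blockA_dotProduct_blockD_sub,
    dotProduct_comm]

/-- **the canonical factorisation on the big cell**: `g = n(D B⁻¹) m(B) w n(B⁻¹ A)` for `g ∈ Sp` with `B`
invertible. [cite: Weil1964, n° 7, Prop. 1, p. 152; Rangarao1993, Thm 4.1, p. 358] -/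
theorem eq_canonicalWord (g : Spι) (hB : Function.Bijective (blockB (g : 𝕍 ≃ₗ[F] 𝕍))) :
    g = 𝐧 (cellGamma (g : 𝕍 ≃ₗ[F] 𝕍) hB) (cellGamma_symm g hB) * 𝐦 (cellB (g : 𝕍 ≃ₗ[F] 𝕍) hB) * 𝐰 *
      𝐧 (cellDelta (g : 𝕍 ≃ₗ[F] 𝕍) hB) (cellDelta_symm g hB) := by
  apply Subtype.ext; apply LinearEquiv.ext; rintro ⟨x, y⟩
  rw [canonicalWord_apply _ _ (cellGamma_symm g hB) (cellDelta_symm g hB), apply_eq_blocks]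
  simp only [map_add, cellB_apply, cellDelta_apply, blockB_cellB_symm_apply, cellGamma_apply,
    cellB_symm_apply_blockB, dualLeviPi_cellB_apply g hB, Prod.mk.injEq]
  constructor
  · abel
  · abel

omit [DecidableEq ι] [Invertible (2 : F)] in
/-- `w ∈ Ω` (its `B`-block is `1`). [cite: Weil1964, n° 7, p. 152] -/
theorem weylSp_mem_bigCell : (𝐰 : Spι) ∈ bigCell (alt (polar (dotProductBilin F F (m := ι)))) ℓY :=
  mem_bigCell_of_blockB_bijective _ (by
    have : blockB ((𝐰 : Spι) : 𝕍 ≃ₗ[F] 𝕍) = LinearMap.id := by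
      ext y; simp [coe_weylSp]
    rw [this]; exact Function.bijective_id)

end Pi

end Literature.RepresentationTheory.HeisenbergGroup
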